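/-
Copyright (c) 2026 the pub-hodgecm-mathlib formalisation cell (harness21).  Prover seat hodgecm-mathlib-K2E2-p12 (g5): Track B «K2-LIT», ENGINE E1,
h413 = stmt-HodgeConjecture-24833; «EIS-WHITTAKER-3» W3₃ (W-asm) = FILE B2 `…U3C` (dealer K2E1-plan (g5) 09:23:57Z (3), ruling 09:27:38Z: g = k scope, `hW` a letter).
-/
import Summits.HodgeConjecture.HodgeConjecture.Theorems.K2E1WhittakerFinitePartTransportU3         -- ★ (U3C-a) (this seat): the ψ-twisted finite double integral as `C'·μ³(𝒪̂³)·(∏_S W_v)·D^S⁻¹`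
import Summits.HodgeConjecture.HodgeConjecture.Theorems.K2E1AdelicFourierCoeffEulerProductCM          -- ★ W3-ENGINE-ℂ (K2E4-p23): `integral_prod_archCentre_mul_fourierChar_eq_prod`, `measure_map_split_adeleFundamentalDomain_cm`
import Summits.HodgeConjecture.HodgeConjecture.Theorems.K2E1AdelicFourierCoeffEulerProduct            -- ★ W3-ENGINE (K2E3-p12): `adeleFourierCoeff_map_split_eq_mul`, `measurableEmbedding_split`, `integral_prod_mul_fourierChar_eq_prod_of_equiv`
import Summits.HodgeConjecture.HodgeConjecture.Theorems.K2E1WhittakerCoefficientEulerProductU2         -- ★ N = 2 twin (K2E3-p12): `ofReal_inv_mul_cpow`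
import Summits.HodgeConjecture.HodgeConjecture.Theorems.K2E1HeightBigCellLineFormulaU3                 -- ★ (a2)₃: the height on the big cell, `norm_extensionEmbedding`
import Summits.HodgeConjecture.HodgeConjecture.Theorems.K2E1BorelEisensteinUDefs                           -- ★ `flatSectionU`
import HarnessLib

/-!
# K2·E1 — `K2E1WhittakerCoefficientEulerProductU3C` («EIS-WHITTAKER-3» W3₃ FILE B2, (W-asm)): THE `ξ`-TH WHITTAKER COEFFICIENT OF THE SPHERICAL FLAT SECTION OF `U(2,1)_{L∕L⁺}`
# AT `g = k ∈ K_U` IS (ARCHIMEDEAN MELLIN PRODUCT) × (EULER PRODUCT) — `μ_E(D_E)⁻¹·𝓕_E[X ↦ μ_F(D_F)⁻¹ ∫_t f_z(ι(w₀)·u(X,θt)·k) dt](ξ) =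
# c · (∏_{w∣∞} 2π²·4^{1−z}·|δ|_w⁻¹·Γ(z)⁻²·𝓜[e^{−t−8π²|ξ_w|²∕t}](2z−2)) · (∏_{v∈S} W_v(ξ,z)) · [ζ^S_{L⁺}(z)·L^S(z,ε)·L^S(2z−1,ε)]⁻¹` on `1 < Re z` (the `hWeq` RIGHT-HAND SIDE at `g = k`)

Track B ∕ K2-LIT, crux h413 = `stmt-HodgeConjecture-24833`, route of record `HCCMUnconditional`; cell `hodgecm-mathlib`, squad K2, ENGINE E1 (campaign «EIS-WHITTAKER-3», rung W3₃).
THEOREMS ONLY (no `def`, no instance, no notation, no `sorry`; default heartbeats); lane `--supports stmt-HodgeConjecture-24833 --as helper` (count-neutral).  The N = 3 twin of ★ W3 FILES 2∕4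
(`K2E1WhittakerCoefficientEulerProduct[Adelic]U2`).  CONVENTIONS (RULING «LETTERS-μD»): `μ_E := σ_E,*(vol_{L⊗ℝ} ⊗ μ_{E,f})` on `𝔸_L`, `μ_F := σ_F,*(vol_{L⁺⊗ℝ} ⊗ μ_{F,f})` on `𝔸_{L⁺}`
(`σ(s,b) = (ι⁻¹s, b)`, the letters `hσE`, `hσF` of ★ W3-ENGINE); `k ∈ K_U` (`hk`); `f_z = flatSectionU (fun _ => φ₀) z`; `ψ_E` Tate's character; frequency `ξ : L`.
THE CHAIN: §1 pointwise — ★ (a2)₃ `coe_borelHeight_weylLongU_heisChart_line_mul_eq_cm_three` read through `((A·h_f)⁻¹)^z = A^{−z}·h_f^{−z}` (★ `ofReal_inv_mul_cpow`); §2 the centre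
integral over `𝔸_{L⁺} = (L⁺⊗ℝ) × 𝔸_{L⁺,f}` (★ `measurableEmbedding_split`, Mathlib `integral_prod_mul` — no integrability) and the archimedean centre integral as a product over the
places `w ∣ ∞` of `L` ≃ real places of `L⁺` (Mathlib `IsCMField.equivInfinitePlace`, ★ `integral_prod_mul_fourierChar_eq_prod_of_equiv` at `ξ = 0`); §3 the symbol is a PURE TENSOR
`X ↦ (∏_w φ_w((ιX_∞)_w))·Φ_f(X_f)` with `φ_w(Y) = ∫_ℝ ((1+½‖Y‖²)² + (wδ)²x²)^{−z} dx` (`‖(ιX_∞)_w‖ = ‖X_w‖`, ★ `norm_extensionEmbedding`), so ★ W3-ENGINE `adeleFourierCoeff_map_split_eq_mul` splits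
`𝓕_E`, ★ W3-ENGINE-ℂ §3 evaluates the archimedean factor in D-W2-B's Mellin currency (`1 < Re z`), and the finite factor is Fubini (the ONE integrability letter `hfin`) ∘ ★ (U3C-a).
* §1 `flatSectionU_const_weylLongU_heisChart_eq_cm_three`; §2 `integral_flatSectionU_centre_eq`, `integral_archCentre_cpow_eq_prod`; §3 `centreAverage_eq_tensor`;
* §4 HEAD **`exists_pos_whittakerCoeff_eq_arch_mul_eulerProduct_cm_three`**: ONE constant `C' > 0` (★ (U3C-a)'s) with, for every `S₀` (`hgood`), `ξ` (`hξ`), `S` (`hW` — a LETTER, paid by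
  (U3C-c)), `1 < Re z`, `hfin`: the displayed identity, `c = μ_E(D_E)⁻¹·μ_F(D_F)⁻¹·φ₀·C'·μ³(𝒪̂³)`; `W_v(ξ,z)` ★ B1's tokens, `D^S` ★ W3₃-A's, the arch product ★ W3-ENGINE-ℂ §3's — ALL VERBATIM.
HONEST LABEL: HC_CM is proved only modulo the 7 printed citations (2 remaining named inputs: hLiu418 = `stmt-HodgeConjecture-24832`, h413 = `stmt-HodgeConjecture-24833`) until rung 0
closes; this file asserts no named fact and closes no socket; count-neutral; §4 is conditional only on its displayed letters (`hc`, `hk`, `hσE`, `hσF`, `hgood`, `hξ`, `hW`, `hfin`);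
general `g` (W3₃-cov) is NOT here.

## References
* [TateThesis1967] J. Tate, *Fourier analysis in number fields and Hecke's zeta-functions* (1967): §4.1, Thm 3.3.1.
* [Bump1997] D. Bump, *Automorphic Forms and Representations* (1997): §1.6 (1.26), §3.7.
* [Garrett2018] P. Garrett, *Modern Analysis of Automorphic Forms by Example* 1 (2018): §1.9–§1.10, §2.8.
* [MoeglinWaldspurger1995] C. Mœglin, J.-L. Waldspurger, *Spectral Decomposition and Eisenstein Series* (1995): II.1.7.
* [Rogawski1990] J. D. Rogawski, *Automorphic Representations of Unitary Groups in Three Variables* (1990): §4.5.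
-/

set_option autoImplicit false
set_option linter.dupNamespace false -- the mandated namespace repeats `HodgeConjecture.HodgeConjecture`

noncomputable section

open MeasureTheory MeasureTheory.Measure NumberField NumberField.InfinitePlace NumberField.mixedEmbedding IsDedekindDomain Set Filter Topology
open scoped NNReal ENNReal Real FourierTransform Classical
open Literature.NumberTheory.Automorphic Literature.NumberTheory.Automorphic.UnitaryGroup Literature.NumberTheory.GaloisRepresentations
open Literature.NumberTheory.GaloisRepresentations.IsNonarchimedeanLocalField Literature.NumberTheory.LFunctions
open Summit.HodgeConjecture.HodgeConjecture.Cruxes.H413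
open Summit.HodgeConjecture.HodgeConjecture.Cruxes.H413.K2E1AdelicFourierCoeffEulerProduct (adeleFourierCoeff_map_split_eq_mul measurableEmbedding_split integral_prod_mul_fourierChar_eq_prod_of_equiv)
open Summit.HodgeConjecture.HodgeConjecture.Cruxes.H413.K2E1AdelicFourierCoeffEulerProductCM (integral_prod_archCentre_mul_fourierChar_eq_prod)
open Summit.HodgeConjecture.HodgeConjecture.Cruxes.H413.K2E1WhittakerCoefficientEulerProductU2 (ofReal_inv_mul_cpow)
open Summit.HodgeConjecture.HodgeConjecture.Cruxes.H413.K2E1HeightBigCellLineFormulaU3 (coe_borelHeight_weylLongU_heisChart_line_mul_eq_cm_three one_le_coe_finprod_heisZ_line_cm_three norm_extensionEmbedding)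
open Summit.HodgeConjecture.HodgeConjecture.Cruxes.H413.K2E1BorelEisensteinU (flatSectionU flatSectionU_apply)
open Summit.HodgeConjecture.HodgeConjecture.Cruxes.H413.K2E1WhittakerFinitePartTransportU3 (finsetProd_ofReal_cpow exists_pos_integral_prod_heightFactor_cpow_mul_addChar_eq)

namespace Summit.HodgeConjecture.HodgeConjecture.Cruxes.H413.K2E1WhittakerCoefficientEulerProductU3C

variable (L : Type) [Field L] [NumberField L] [IsCMField L] (hc : IsCMField.complexConj L * IsCMField.complexConj L = 1)
  {δ : L} (hcδ : IsCMField.complexConj L δ = -δ) (hδ : δ ≠ 0)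
  {k : (quasiSplit (↥(maximalRealSubfield L)) L (IsCMField.complexConj L) 3).Adelic}
  (hk : k ∈ ((standardMaximalCompactGL 3 L).comap (adelicVal ↥(maximalRealSubfield L) L (IsCMField.complexConj L) 3 ((StdForm.antidiagonal 3).over L)) : Subgroup (quasiSplit (↥(maximalRealSubfield L)) L (IsCMField.complexConj L) 3).Adelic))

/-! ## §1 Pointwise: the spherical flat section on the big cell, in complex powers -/

omit [NumberField L] [IsCMField L] in
/-- The archimedean place product `A(X_∞, s) = ∏_w ((1+½‖X_w‖²)² + (wδ)²s_w²)` is positive. [folklore] -/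
theorem archFactor_pos [NumberField L] [IsCMField L] (Xi : InfiniteAdeleRing L) (s : mixedSpace ↥(maximalRealSubfield L)) : 0 < (∏ w : InfinitePlace L, ((1 + ‖(Xi) w‖ ^ 2 / 2) ^ 2 + (w δ) ^ 2 * ((s).1 ⟨w.comap (algebraMap ↥(maximalRealSubfield L) L), K2E1HeightBigCellLineFormulaU2.isReal_comap_maximalRealSubfield L w⟩) ^ 2)) :=
  Finset.prod_pos fun w _ => by positivity

include hc hk in
/-- **`f_z(ι(w₀)·u(X, θ t)·k) = φ₀ · A(X_∞, ι t_∞)^{−z} · h_f(X, t_f)^{−z}`** in `ℂ` for `k ∈ K_U`, every `z`, `X ∈ 𝔸_L`, `t ∈ 𝔸_{L⁺}` (★ (a2)₃ at `s = ι t_∞`, `t = (ι⁻¹(ι t_∞), t_f)`;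
★ `ofReal_inv_mul_cpow`, `A > 0`, `h_f ≥ 1`). [cite: MoeglinWaldspurger1995, II.1.7] [cite: Garrett2018, §2.8] -/
theorem flatSectionU_const_weylLongU_heisChart_eq_cm_three (φ₀ z : ℂ) (X : AdeleRing (𝓞 L) L) (t : AdeleRing (𝓞 ↥(maximalRealSubfield L)) ↥(maximalRealSubfield L)) :
    flatSectionU (fun _ : (quasiSplit (↥(maximalRealSubfield L)) L (IsCMField.complexConj L) 3).Adelic => φ₀) z (((quasiSplit (↥(maximalRealSubfield L)) L (IsCMField.complexConj L) 3).toAdelic (weylLongU ((IsCMField.complexConj L : L ≃ₐ[↥(maximalRealSubfield L)] L) : L →+* L) (rfl : ((StdForm.antidiagonal 3).over L) = ((StdForm.antidiagonal 3).over L)))) * (((heisChart hc (X, traceZeroLine ↥(maximalRealSubfield L) L (IsCMField.complexConj L) hcδ hδ t)) : ↥(adelicUnipotent ↥(maximalRealSubfield L) L (IsCMField.complexConj L) 3)) : (quasiSplit (↥(maximalRealSubfield L)) L (IsCMField.complexConj L) 3).Adelic) * k) =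
      φ₀ * (((((∏ w : InfinitePlace L, ((1 + ‖(X.1) w‖ ^ 2 / 2) ^ 2 + (w δ) ^ 2 * (((InfiniteAdeleRing.ringEquiv_mixedSpace ↥(maximalRealSubfield L)) t.1).1 ⟨w.comap (algebraMap ↥(maximalRealSubfield L) L), K2E1HeightBigCellLineFormulaU2.isReal_comap_maximalRealSubfield L w⟩) ^ 2)) : ℝ) : ℂ) ^ (-z)) *
        ((((∏ᶠ w : HeightOneSpectrum (𝓞 L), max 1 (max ‖((X) : AdeleRing (𝓞 L) L).2 w‖₊ ‖(heisZ (c := IsCMField.complexConj L) ((X) : AdeleRing (𝓞 L) L) ((traceZeroLine ↥(maximalRealSubfield L) L (IsCMField.complexConj L) hcδ hδ ((0, t.2) : AdeleRing (𝓞 ↥(maximalRealSubfield L)) ↥(maximalRealSubfield L)) : traceZeroAdele ↥(maximalRealSubfield L) L (IsCMField.complexConj L)) : AdeleRing (𝓞 L) L)).2 w‖₊) : ℝ≥0) : ℝ) : ℂ) ^ (-z))) := by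
  have ht : t = (((InfiniteAdeleRing.ringEquiv_mixedSpace ↥(maximalRealSubfield L)).symm ((InfiniteAdeleRing.ringEquiv_mixedSpace ↥(maximalRealSubfield L)) t.1), t.2) : AdeleRing (𝓞 ↥(maximalRealSubfield L)) ↥(maximalRealSubfield L)) := Prod.ext ((InfiniteAdeleRing.ringEquiv_mixedSpace ↥(maximalRealSubfield L)).symm_apply_apply _).symm rfl
  rw [flatSectionU_apply]
  conv_lhs => rw [ht]
  rw [coe_borelHeight_weylLongU_heisChart_line_mul_eq_cm_three L hc hcδ hδ hk X t.2 ((InfiniteAdeleRing.ringEquiv_mixedSpace ↥(maximalRealSubfield L)) t.1)]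
  rw [ofReal_inv_mul_cpow (archFactor_pos L X.1 _) (lt_of_lt_of_le one_pos (one_le_coe_finprod_heisZ_line_cm_three L hcδ hδ X t.2)) z]

omit [NumberField L] [IsCMField L] in
/-- `‖(ι X_∞)_w‖ = ‖X_w‖` at a complex place (Mathlib `ringEquiv_mixedSpace_apply`, ★ `norm_extensionEmbedding`). [folklore] -/
theorem norm_ringEquiv_mixedSpace_snd (Xi : InfiniteAdeleRing L) (w : InfinitePlace L) (hw : w.IsComplex) :
    ‖((InfiniteAdeleRing.ringEquiv_mixedSpace L) Xi).2 ⟨w, hw⟩‖ = ‖Xi w‖ := by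
  rw [InfiniteAdeleRing.ringEquiv_mixedSpace_apply]
  exact norm_extensionEmbedding L w (Xi w)


/-! ## §2 The centre integral over `𝔸_{L⁺} = (L⁺ ⊗ ℝ) × 𝔸_{L⁺,f}` and its archimedean part as a product over the places -/

section Centre

variable [MeasurableSpace (AdeleRing (𝓞 ↥(maximalRealSubfield L)) ↥(maximalRealSubfield L))] [BorelSpace (AdeleRing (𝓞 ↥(maximalRealSubfield L)) ↥(maximalRealSubfield L))]
  [MeasurableSpace (FiniteAdeleRing (𝓞 ↥(maximalRealSubfield L)) ↥(maximalRealSubfield L))] [BorelSpace (FiniteAdeleRing (𝓞 ↥(maximalRealSubfield L)) ↥(maximalRealSubfield L))]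
  (μFf : Measure (FiniteAdeleRing (𝓞 ↥(maximalRealSubfield L)) ↥(maximalRealSubfield L))) [SFinite μFf]
  {σF : mixedSpace ↥(maximalRealSubfield L) × FiniteAdeleRing (𝓞 ↥(maximalRealSubfield L)) ↥(maximalRealSubfield L) → AdeleRing (𝓞 ↥(maximalRealSubfield L)) ↥(maximalRealSubfield L)}
  (hσF : ∀ p, (σF p).1 = (InfiniteAdeleRing.ringEquiv_mixedSpace ↥(maximalRealSubfield L)).symm p.1 ∧ (σF p).2 = p.2)

include hc hk hσF in
/-- **THE CENTRE INTEGRAL SPLITS**: `∫_{𝔸_{L⁺}} f_z(ι(w₀)·u(X, θt)·k) dμ_F(t) = φ₀ · (∫_{L⁺⊗ℝ} A(X_∞, s)^{−z} ds) · (∫_{𝔸_{L⁺,f}} h_f(X, b)^{−z} dμ_{F,f}(b))` for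
`μ_F = σ_F,*(vol ⊗ μ_{F,f})` (§1 pointwise; change of variables along the measurable embedding `σ_F` ★; Mathlib `integral_prod_mul` — no integrability hypothesis).
[cite: TateThesis1967, §4.1] [cite: Garrett2018, §1.9] -/
theorem integral_flatSectionU_centre_eq (φ₀ z : ℂ) (X : AdeleRing (𝓞 L) L) :
    ∫ t : AdeleRing (𝓞 ↥(maximalRealSubfield L)) ↥(maximalRealSubfield L), flatSectionU (fun _ : (quasiSplit (↥(maximalRealSubfield L)) L (IsCMField.complexConj L) 3).Adelic => φ₀) z (((quasiSplit (↥(maximalRealSubfield L)) L (IsCMField.complexConj L) 3).toAdelic (weylLongU ((IsCMField.complexConj L : L ≃ₐ[↥(maximalRealSubfield L)] L) : L →+* L) (rfl : ((StdForm.antidiagonal 3).over L) = ((StdForm.antidiagonal 3).over L)))) * (((heisChart hc (X, traceZeroLine ↥(maximalRealSubfield L) L (IsCMField.complexConj L) hcδ hδ t)) : ↥(adelicUnipotent ↥(maximalRealSubfield L) L (IsCMField.complexConj L) 3)) : (quasiSplit (↥(maximalRealSubfield L)) L (IsCMField.complexConj L) 3).Adelic) * k) ∂(((volume : Measure (mixedSpace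 ↥(maximalRealSubfield L))).prod μFf).map σF) =
      φ₀ * ((∫ s : mixedSpace ↥(maximalRealSubfield L), ((((∏ w : InfinitePlace L, ((1 + ‖(X.1) w‖ ^ 2 / 2) ^ 2 + (w δ) ^ 2 * ((s).1 ⟨w.comap (algebraMap ↥(maximalRealSubfield L) L), K2E1HeightBigCellLineFormulaU2.isReal_comap_maximalRealSubfield L w⟩) ^ 2)) : ℝ) : ℂ) ^ (-z))) *
        ∫ b : FiniteAdeleRing (𝓞 ↥(maximalRealSubfield L)) ↥(maximalRealSubfield L), ((((∏ᶠ w : HeightOneSpectrum (𝓞 L), max 1 (max ‖((X) : AdeleRing (𝓞 L) L).2 w‖₊ ‖(heisZ (c := IsCMField.complexConj L) ((X) : AdeleRing (𝓞 L) L) ((traceZeroLine ↥(maximalRealSubfield L) L (IsCMField.complexConj L) hcδ hδ ((0, b) : AdeleRing (𝓞 ↥(maximalRealSubfield L)) ↥(maximalRealSubfield L)) : traceZeroAdele ↥(maximalRealSubfield L) L (IsCMField.complexConj L)) : AdeleRing (𝓞 L) L)).2 w‖₊) : ℝ≥0) : ℝ) : ℂ) ^ (-z)) ∂μFf) := by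
  rw [(measurableEmbedding_split ↥(maximalRealSubfield L) hσF).integral_map]
  have hpt : ∀ p : mixedSpace ↥(maximalRealSubfield L) × FiniteAdeleRing (𝓞 ↥(maximalRealSubfield L)) ↥(maximalRealSubfield L),
      flatSectionU (fun _ : (quasiSplit (↥(maximalRealSubfield L)) L (IsCMField.complexConj L) 3).Adelic => φ₀) z (((quasiSplit (↥(maximalRealSubfield L)) L (IsCMField.complexConj L) 3).toAdelic (weylLongU ((IsCMField.complexConj L : L ≃ₐ[↥(maximalRealSubfield L)] L) : L →+* L) (rfl : ((StdForm.antidiagonal 3).over L) = ((StdForm.antidiagonal 3).over L)))) * (((heisChart hc (X, traceZeroLine ↥(maximalRealSubfield L) L (IsCMField.complexConj L) hcδ hδ (σF p))) : ↥(adelicUnipotent ↥(maximalRealSubfield L) L (IsCMField.complexConj L) 3)) : (quasiSplit (↥(maximalRealSubfield L)) L (IsCMField.complexConj L) 3).Adelic) * k) =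
        φ₀ * (((((∏ w : InfinitePlace L, ((1 + ‖(X.1) w‖ ^ 2 / 2) ^ 2 + (w δ) ^ 2 * ((p.1).1 ⟨w.comap (algebraMap ↥(maximalRealSubfield L) L), K2E1HeightBigCellLineFormulaU2.isReal_comap_maximalRealSubfield L w⟩) ^ 2)) : ℝ) : ℂ) ^ (-z)) *
          ((((∏ᶠ w : HeightOneSpectrum (𝓞 L), max 1 (max ‖((X) : AdeleRing (𝓞 L) L).2 w‖₊ ‖(heisZ (c := IsCMField.complexConj L) ((X) : AdeleRing (𝓞 L) L) ((traceZeroLine ↥(maximalRealSubfield L) L (IsCMField.complexConj L) hcδ hδ ((0, p.2) : AdeleRing (𝓞 ↥(maximalRealSubfield L)) ↥(maximalRealSubfield L)) : traceZeroAdele ↥(maximalRealSubfield L) L (IsCMField.complexConj L)) : AdeleRing (𝓞 L) L)).2 w‖₊) : ℝ≥0) : ℝ) : ℂ) ^ (-z))) := fun p => by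
    rw [flatSectionU_const_weylLongU_heisChart_eq_cm_three L hc hcδ hδ hk φ₀ z X (σF p), (hσF p).1, (hσF p).2, RingEquiv.apply_symm_apply]
  simp_rw [hpt]
  rw [integral_const_mul, integral_prod_mul (μ := (volume : Measure (mixedSpace ↥(maximalRealSubfield L)))) (ν := μFf)
    (fun s : mixedSpace ↥(maximalRealSubfield L) => ((((∏ w : InfinitePlace L, ((1 + ‖(X.1) w‖ ^ 2 / 2) ^ 2 + (w δ) ^ 2 * ((s).1 ⟨w.comap (algebraMap ↥(maximalRealSubfield L) L), K2E1HeightBigCellLineFormulaU2.isReal_comap_maximalRealSubfield L w⟩) ^ 2)) : ℝ) : ℂ) ^ (-z)))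
    (fun b : FiniteAdeleRing (𝓞 ↥(maximalRealSubfield L)) ↥(maximalRealSubfield L) => ((((∏ᶠ w : HeightOneSpectrum (𝓞 L), max 1 (max ‖((X) : AdeleRing (𝓞 L) L).2 w‖₊ ‖(heisZ (c := IsCMField.complexConj L) ((X) : AdeleRing (𝓞 L) L) ((traceZeroLine ↥(maximalRealSubfield L) L (IsCMField.complexConj L) hcδ hδ ((0, b) : AdeleRing (𝓞 ↥(maximalRealSubfield L)) ↥(maximalRealSubfield L)) : traceZeroAdele ↥(maximalRealSubfield L) L (IsCMField.complexConj L)) : AdeleRing (𝓞 L) L)).2 w‖₊) : ℝ≥0) : ℝ) : ℂ) ^ (-z)))]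

omit [MeasurableSpace (AdeleRing (𝓞 ↥(maximalRealSubfield L)) ↥(maximalRealSubfield L))] [BorelSpace (AdeleRing (𝓞 ↥(maximalRealSubfield L)) ↥(maximalRealSubfield L))]
  [MeasurableSpace (FiniteAdeleRing (𝓞 ↥(maximalRealSubfield L)) ↥(maximalRealSubfield L))] [BorelSpace (FiniteAdeleRing (𝓞 ↥(maximalRealSubfield L)) ↥(maximalRealSubfield L))] [SFinite μFf] in
/-- **THE ARCHIMEDEAN CENTRE INTEGRAL IS A PRODUCT OVER THE PLACES `w ∣ ∞` OF `L`**: `∫_{L⁺⊗ℝ} A(X_∞, s)^{−z} ds = ∏_w ∫_ℝ ((1+½‖X_w‖²)² + (wδ)²x²)^{−z} dx` (the symbol is a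
product of one-variable symbols in the coordinates `s_{w∣L⁺}`, ★ `finsetProd_ofReal_cpow`; the places of `L⁺` are the `w∣_{L⁺}`, Mathlib `IsCMField.equivInfinitePlace`; ★ W3-ENGINE
`integral_prod_mul_fourierChar_eq_prod_of_equiv` at the frequency `0`). [cite: Bump1997, §1.6 (1.26)] [cite: Garrett2018, §1.10] -/
theorem integral_archCentre_cpow_eq_prod (z : ℂ) (Xi : InfiniteAdeleRing L) :
    ∫ s : mixedSpace ↥(maximalRealSubfield L), ((((∏ w : InfinitePlace L, ((1 + ‖(Xi) w‖ ^ 2 / 2) ^ 2 + (w δ) ^ 2 * ((s).1 ⟨w.comap (algebraMap ↥(maximalRealSubfield L) L), K2E1HeightBigCellLineFormulaU2.isReal_comap_maximalRealSubfield L w⟩) ^ 2)) : ℝ) : ℂ) ^ (-z)) = (∏ w : InfinitePlace L, ∫ x : ℝ, ((((1 + ‖Xi w‖ ^ 2 / 2) ^ 2 + (w δ) ^ 2 * x ^ 2 : ℝ)) : ℂ) ^ (-z)) := by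
  let e' : InfinitePlace L ≃ {v : InfinitePlace ↥(maximalRealSubfield L) // v.IsReal} :=
    (IsCMField.equivInfinitePlace L).trans (Equiv.subtypeUnivEquiv fun v : InfinitePlace ↥(maximalRealSubfield L) => IsTotallyReal.isReal v).symm
  have he : ∀ w : InfinitePlace L, e' w = ⟨w.comap (algebraMap ↥(maximalRealSubfield L) L), K2E1HeightBigCellLineFormulaU2.isReal_comap_maximalRealSubfield L w⟩ := fun w => rfl
  have key := integral_prod_mul_fourierChar_eq_prod_of_equiv ↥(maximalRealSubfield L) e' (fun w (x : ℝ) => ((((1 + ‖Xi w‖ ^ 2 / 2) ^ 2 + (w δ) ^ 2 * x ^ 2 : ℝ)) : ℂ) ^ (-z)) 0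
  simp only [he, map_zero, zero_mul, neg_zero, AddChar.map_zero_eq_one, Prod.fst_zero, Pi.zero_apply] at key
  simp only [Circle.coe_one, mul_one, Complex.ofReal_zero, mul_zero, zero_mul, neg_zero, Complex.exp_zero] at key
  rw [← key]
  refine integral_congr_ae (Eventually.of_forall fun s => ?_)
  exact finsetProd_ofReal_cpow Finset.univ _ (fun w _ => by positivity) (-z)

end Centre

/-! ## §3 The centre average is a pure tensor in `X = (X_∞, X_f)` -/

section Tensor

variable [MeasurableSpace (AdeleRing (𝓞 ↥(maximalRealSubfield L)) ↥(maximalRealSubfield L))] [BorelSpace (AdeleRing (𝓞 ↥(maximalRealSubfield L)) ↥(maximalRealSubfield L))]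
  [MeasurableSpace (FiniteAdeleRing (𝓞 ↥(maximalRealSubfield L)) ↥(maximalRealSubfield L))] [BorelSpace (FiniteAdeleRing (𝓞 ↥(maximalRealSubfield L)) ↥(maximalRealSubfield L))]
  (μFf : Measure (FiniteAdeleRing (𝓞 ↥(maximalRealSubfield L)) ↥(maximalRealSubfield L))) [SFinite μFf]
  {σF : mixedSpace ↥(maximalRealSubfield L) × FiniteAdeleRing (𝓞 ↥(maximalRealSubfield L)) ↥(maximalRealSubfield L) → AdeleRing (𝓞 ↥(maximalRealSubfield L)) ↥(maximalRealSubfield L)}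
  (hσF : ∀ p, (σF p).1 = (InfiniteAdeleRing.ringEquiv_mixedSpace ↥(maximalRealSubfield L)).symm p.1 ∧ (σF p).2 = p.2)

include hc hk hσF in
/-- **THE CENTRE AVERAGE IS A PURE TENSOR**: `X ↦ κ_F·∫_t f_z(ι(w₀)·u(X,θt)·k) dμ_F(t)` IS `X ↦ Φ_∞(ιX_∞)·Φ_f(X_f)` with `Φ_∞(s) = ∏_w ∫_ℝ ((1+½‖s_w‖²)² + (wδ)²x²)^{−z} dx` (`s_w = s.2 ⟨w,·⟩`,
all places complex) and `Φ_f(X_f) = κ_F·φ₀·∫ h_f((0,X_f), b)^{−z} dμ_{F,f}` (§2; `h_f` sees `X` only through `X_f`, definitionally). [cite: Garrett2018, §1.9–§1.10] [cite: MoeglinWaldspurger1995, II.1.7] -/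
theorem centreAverage_eq_tensor (κF φ₀ z : ℂ) :
    (fun X : AdeleRing (𝓞 L) L => κF * ∫ t : AdeleRing (𝓞 ↥(maximalRealSubfield L)) ↥(maximalRealSubfield L), flatSectionU (fun _ : (quasiSplit (↥(maximalRealSubfield L)) L (IsCMField.complexConj L) 3).Adelic => φ₀) z (((quasiSplit (↥(maximalRealSubfield L)) L (IsCMField.complexConj L) 3).toAdelic (weylLongU ((IsCMField.complexConj L : L ≃ₐ[↥(maximalRealSubfield L)] L) : L →+* L) (rfl : ((StdForm.antidiagonal 3).over L) = ((StdForm.antidiagonal 3).over L)))) * (((heisChart hc (X, traceZeroLine ↥(maximalRealSubfield L) L (IsCMField.complexConj L) hcδ hδ t)) : ↥(adelicUnipotent ↥(maximalRealSubfield L) L (IsCMField.complexConj L) 3)) : (quasiSplit (↥(maximalRealSubfield L)) L (IsCMField.complexConj L) 3).Adelic) * k) ∂(((volume : Measure (mixedSpace ↥(maximalRealSubfield L))).prod μFf).map σF)) =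
      fun X : AdeleRing (𝓞 L) L =>
        (∏ w : InfinitePlace L, ∫ x : ℝ, ((((1 + ‖((InfiniteAdeleRing.ringEquiv_mixedSpace L) X.1).2 ⟨w, IsTotallyComplex.isComplex w⟩‖ ^ 2 / 2) ^ 2 + (w δ) ^ 2 * x ^ 2 : ℝ)) : ℂ) ^ (-z)) *
          (κF * φ₀ * ∫ b : FiniteAdeleRing (𝓞 ↥(maximalRealSubfield L)) ↥(maximalRealSubfield L), ((((∏ᶠ w : HeightOneSpectrum (𝓞 L), max 1 (max ‖((((0 : InfiniteAdeleRing L)), X.2) : AdeleRing (𝓞 L) L).2 w‖₊ ‖(heisZ (c := IsCMField.complexConj L) ((((0 : InfiniteAdeleRing L)), X.2) : AdeleRing (𝓞 L) L) ((traceZeroLine ↥(maximalRealSubfield L) L (IsCMField.complexConj L) hcδ hδ ((0, b) : AdeleRing (𝓞 ↥(maximalRealSubfield L)) ↥(maximalRealSubfield L)) : traceZeroAdele ↥(maximalRealSubfield L) L (IsCMField.complexConj L)) : AdeleRing (𝓞 L) L)).2 w‖₊) : ℝ≥0) : ℝ) : ℂ) ^ (-z)) ∂μFf) := by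
  haveI : IsTotallyComplex L := IsCMField.isTotallyComplex L
  funext X
  rw [integral_flatSectionU_centre_eq L hc hcδ hδ hk μFf hσF φ₀ z X, integral_archCentre_cpow_eq_prod L z X.1]
  have hnorm : ∀ w : InfinitePlace L, ‖((InfiniteAdeleRing.ringEquiv_mixedSpace L) X.1).2 ⟨w, IsTotallyComplex.isComplex w⟩‖ = ‖X.1 w‖ := fun w => norm_ringEquiv_mixedSpace_snd L X.1 w _
  simp_rw [hnorm]
  have hfin : (∫ b : FiniteAdeleRing (𝓞 ↥(maximalRealSubfield L)) ↥(maximalRealSubfield L), ((((∏ᶠ w : HeightOneSpectrum (𝓞 L), max 1 (max ‖((((0 : InfiniteAdeleRing L)), X.2) : AdeleRing (𝓞 L) L).2 w‖₊ ‖(heisZ (c := IsCMField.complexConj L) ((((0 : InfiniteAdeleRing L)), X.2) : AdeleRing (𝓞 L) L) ((traceZeroLine ↥(maximalRealSubfield L) L (IsCMField.complexConj L) hcδ hδ ((0, b) : AdeleRing (𝓞 ↥(maximalRealSubfield L)) ↥(maximalRealSubfield L)) : traceZeroAdele ↥(maximalRealSubfield L) L (IsCMField.complexConj L)) : AdeleRing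 (𝓞 L) L)).2 w‖₊) : ℝ≥0) : ℝ) : ℂ) ^ (-z)) ∂μFf) =
      ∫ b : FiniteAdeleRing (𝓞 ↥(maximalRealSubfield L)) ↥(maximalRealSubfield L), ((((∏ᶠ w : HeightOneSpectrum (𝓞 L), max 1 (max ‖((X) : AdeleRing (𝓞 L) L).2 w‖₊ ‖(heisZ (c := IsCMField.complexConj L) ((X) : AdeleRing (𝓞 L) L) ((traceZeroLine ↥(maximalRealSubfield L) L (IsCMField.complexConj L) hcδ hδ ((0, b) : AdeleRing (𝓞 ↥(maximalRealSubfield L)) ↥(maximalRealSubfield L)) : traceZeroAdele ↥(maximalRealSubfield L) L (IsCMField.complexConj L)) : AdeleRing (𝓞 L) L)).2 w‖₊) : ℝ≥0) : ℝ) : ℂ) ^ (-z)) ∂μFf := rfl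
  rw [hfin]
  ring

end Tensor

/-! ## §4 HEAD: the `ξ`-th Whittaker coefficient at `g = k` is (archimedean Mellin product) × (Euler product) -/

include hc hk in
/-- **THE `ξ`-TH WHITTAKER COEFFICIENT OF THE SPHERICAL FLAT SECTION OF `U(2,1)_{L∕L⁺}` AT `g = k ∈ K_U`** (`μ_E = σ_E,*(vol ⊗ μ_{E,f})`, `μ_F = σ_F,*(vol ⊗ μ_{F,f})`): there is ONE
constant `C' > 0` (★ (U3C-a)'s: the CM transport constant) such that for every bad finset `S₀` (`hgood`), every `ξ : L` integral above `S₀ᶜ` (`hξ`), every finset `S` carrying the NAMED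
unit values of ★ B1's local Whittaker tokens (`hW`), every `z` with `1 < Re z`, and the finite integrability letter `hfin`:
`μ_E(D_E)⁻¹ · 𝓕_E[X ↦ μ_F(D_F)⁻¹·∫_t f_z(ι(w₀)·u(X, θt)·k) dμ_F(t)](ξ) = (μ_E(D_E)⁻¹·μ_F(D_F)⁻¹·φ₀·C'·μ³(𝒪̂³)) · (∏_{w∣∞} 2π²·4^{1−z}·(wδ)⁻¹·Γ(z)⁻²·𝓜[e^{−t−8π²‖ξ_w‖²∕t}](2z−2)) · ((∏_{v∈S} W_v(ξ,z)) · D^S(z)⁻¹)`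
— the RIGHT-HAND SIDE of ★ W5₃-FINAL's letter `hWeq` at `g = k`, in ★ C3₃-A's letter shape `c·A·F·D` (§3 ∘ ★ W3-ENGINE `adeleFourierCoeff_map_split_eq_mul` ∘ ★ W3-ENGINE-ℂ §3 ∘ Fubini ∘ ★ (U3C-a)).
[cite: TateThesis1967, §4.1, Thm 3.3.1] [cite: Bump1997, §3.7] [cite: Garrett2018, §1.9–§1.10] [cite: Rogawski1990, §4.5] -/
theorem exists_pos_whittakerCoeff_eq_arch_mul_eulerProduct_cm_three {d : ↥(maximalRealSubfield L)} (hd : δ * δ = algebraMap ↥(maximalRealSubfield L) L d)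
    [MeasurableSpace (AdeleRing (𝓞 L) L)] [BorelSpace (AdeleRing (𝓞 L) L)]
    [MeasurableSpace (AdeleRing (𝓞 ↥(maximalRealSubfield L)) ↥(maximalRealSubfield L))] [BorelSpace (AdeleRing (𝓞 ↥(maximalRealSubfield L)) ↥(maximalRealSubfield L))]
    [MeasurableSpace (FiniteAdeleRing (𝓞 L) L)] [BorelSpace (FiniteAdeleRing (𝓞 L) L)]
    [MeasurableSpace (FiniteAdeleRing (𝓞 ↥(maximalRealSubfield L)) ↥(maximalRealSubfield L))] [BorelSpace (FiniteAdeleRing (𝓞 ↥(maximalRealSubfield L)) ↥(maximalRealSubfield L))]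
    [∀ v : HeightOneSpectrum (𝓞 ↥(maximalRealSubfield L)), MeasurableSpace (v.adicCompletion ↥(maximalRealSubfield L))] [∀ v : HeightOneSpectrum (𝓞 ↥(maximalRealSubfield L)), BorelSpace (v.adicCompletion ↥(maximalRealSubfield L))]
    (μEf : Measure (FiniteAdeleRing (𝓞 L) L)) [μEf.IsAddHaarMeasure] (μFf : Measure (FiniteAdeleRing (𝓞 ↥(maximalRealSubfield L)) ↥(maximalRealSubfield L))) [μFf.IsAddHaarMeasure]
    (νv : ∀ v : HeightOneSpectrum (𝓞 ↥(maximalRealSubfield L)), Measure (v.adicCompletion ↥(maximalRealSubfield L))) [∀ v, (νv v).IsAddHaarMeasure]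
    {σE : mixedSpace L × FiniteAdeleRing (𝓞 L) L → AdeleRing (𝓞 L) L} (hσE : ∀ p, (σE p).1 = (InfiniteAdeleRing.ringEquiv_mixedSpace L).symm p.1 ∧ (σE p).2 = p.2)
    {σF : mixedSpace ↥(maximalRealSubfield L) × FiniteAdeleRing (𝓞 ↥(maximalRealSubfield L)) ↥(maximalRealSubfield L) → AdeleRing (𝓞 ↥(maximalRealSubfield L)) ↥(maximalRealSubfield L)} (hσF : ∀ p, (σF p).1 = (InfiniteAdeleRing.ringEquiv_mixedSpace ↥(maximalRealSubfield L)).symm p.1 ∧ (σF p).2 = p.2)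
    (φ₀ : ℂ) :
    ∃ C' : ℝ≥0, 0 < C' ∧ ∀ (S₀ : Finset (HeightOneSpectrum (𝓞 ↥(maximalRealSubfield L))))
      (hgood : ∀ v ∉ S₀, Algebra.IsUnramifiedIn (𝓞 L) v.asIdeal ∧ Valued.v (2 : v.adicCompletion ↥(maximalRealSubfield L)) = 1 ∧
        ∀ w : PlacesOver L v, Valued.v (algebraMap L (LocalRing L v) δ w) = 1)
      (ξ : L) (hξ : ∀ v ∉ S₀, ∀ w' : PlacesOver L v, (ξ : w'.1.adicCompletion L) ∈ w'.1.adicCompletionIntegers L)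
      (S : Finset (HeightOneSpectrum (𝓞 ↥(maximalRealSubfield L)))) {z : ℂ} (hz : 1 < z.re)
      (hfin : Integrable (fun q : FiniteAdeleRing (𝓞 L) L × FiniteAdeleRing (𝓞 ↥(maximalRealSubfield L)) ↥(maximalRealSubfield L) => ((((∏ᶠ w : HeightOneSpectrum (𝓞 L), max 1 (max ‖((((0 : InfiniteAdeleRing L)), q.1) : AdeleRing (𝓞 L) L).2 w‖₊ ‖(heisZ (c := IsCMField.complexConj L) ((((0 : InfiniteAdeleRing L)), q.1) : AdeleRing (𝓞 L) L) ((traceZeroLine ↥(maximalRealSubfield L) L (IsCMField.complexConj L) hcδ hδ ((0, q.2) : AdeleRing (𝓞 ↥(maximalRealSubfield L)) ↥(maximalRealSubfield L)) : traceZeroAdele ↥(maximalRealSubfield L) L (IsCMField.complexConj L)) : AdeleRing (𝓞 L) L)).2 w‖₊) : ℝ≥0) : ℝ) : ℂ) ^ (-z))) (μEf.prod μFf))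
      (hW : ∀ v ∉ S, ((Measure.pi fun _ : Fin 3 => νv v) (integralBox ↥(maximalRealSubfield L) (Fin 3) v)).toReal⁻¹ •
          ∫ p : Fin 3 → v.adicCompletion ↥(maximalRealSubfield L),
            ((((∏ w' : PlacesOver L v, max 1 (max ((normAbs (w'.1.adicCompletion L) (quadraticLocalEquiv L v (IsCMField.complexConj L) hcδ hδ (p 0, p 1) w') : ℝ≥0) : ℝ)
          ((normAbs (w'.1.adicCompletion L) ((toLocalRing L v (p 2) * algebraMap L (LocalRing L v) δ -
            toLocalRing L v 2⁻¹ * (quadraticLocalEquiv L v (IsCMField.complexConj L) hcδ hδ (p 0, p 1) *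
              conjLocal L (IsCMField.complexConj L) v (quadraticLocalEquiv L v (IsCMField.complexConj L) hcδ hδ (p 0, p 1)))) w') : ℝ≥0) : ℝ))) : ℝ) : ℂ) ^ (-z)) *
              (∏ w' : PlacesOver L v, (adeleAddCharAt L w'.1 ((ξ : w'.1.adicCompletion L) * quadraticLocalEquiv L v (IsCMField.complexConj L) hcδ hδ (p 0, p 1) w') : ℂ))
            ∂(Measure.pi fun _ : Fin 3 => νv v) =
        (1 - (v.residueCard : ℂ) ^ (-z)) * (1 - (quadraticHeckeCharCM L).valueAtUniformizer v * (v.residueCard : ℂ) ^ (-z)) *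
        (1 - (quadraticHeckeCharCM L).valueAtUniformizer v * (v.residueCard : ℂ) ^ (-(2 * z - 1)))),
      ((((((volume : Measure (mixedSpace L)).prod μEf).map σE) (adeleFundamentalDomain L)).toReal⁻¹ : ℝ) : ℂ) *
          adeleFourierCoeff (((volume : Measure (mixedSpace L)).prod μEf).map σE)
            (fun X : AdeleRing (𝓞 L) L => ((((((volume : Measure (mixedSpace ↥(maximalRealSubfield L))).prod μFf).map σF) (adeleFundamentalDomain ↥(maximalRealSubfield L))).toReal⁻¹ : ℝ) : ℂ) *
              ∫ t : AdeleRing (𝓞 ↥(maximalRealSubfield L)) ↥(maximalRealSubfield L), flatSectionU (fun _ : (quasiSplit (↥(maximalRealSubfield L)) L (IsCMField.complexConj L) 3).Adelic => φ₀) z (((quasiSplit (↥(maximalRealSubfield L)) L (IsCMField.complexConj L) 3).toAdelic (weylLongU ((IsCMField.complexConj L : L ≃ₐ[↥(maximalRealSubfield L)] L) : L →+* L) (rfl : ((StdForm.antidiagonal 3).over L) = ((StdForm.antidiagonal 3).over L)))) * (((heisChart hc (X, traceZeroLine ↥(maximalRealSubfield L) L (IsCMField.complexConj L) hcδ hδ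 t)) : ↥(adelicUnipotent ↥(maximalRealSubfield L) L (IsCMField.complexConj L) 3)) : (quasiSplit (↥(maximalRealSubfield L)) L (IsCMField.complexConj L) 3).Adelic) * k) ∂(((volume : Measure (mixedSpace ↥(maximalRealSubfield L))).prod μFf).map σF)) ξ =
        (((((((volume : Measure (mixedSpace L)).prod μEf).map σE) (adeleFundamentalDomain L)).toReal⁻¹ : ℝ) : ℂ) * ((((((volume : Measure (mixedSpace ↥(maximalRealSubfield L))).prod μFf).map σF) (adeleFundamentalDomain ↥(maximalRealSubfield L))).toReal⁻¹ : ℝ) : ℂ) * φ₀ * (C' : ℂ) *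
            ((((Measure.pi fun _ : Fin 3 => μFf) (offBox (K := ↥(maximalRealSubfield L)) (ι := Fin 3) ∅)).toReal : ℂ))) *
          (∏ w : InfinitePlace L, 2 * (π : ℂ) ^ 2 * (4 : ℂ) ^ (1 - z) * (((w δ : ℝ)) : ℂ)⁻¹ * (Complex.Gamma z)⁻¹ ^ 2 *
          mellin (fun t : ℝ => Complex.exp (-(t : ℂ) - ((8 * π ^ 2 * ‖w.embedding ξ‖ ^ 2 : ℝ) : ℂ) / (t : ℂ))) (2 * z - 2)) *
          ((∏ v ∈ S, ((Measure.pi fun _ : Fin 3 => νv v) (integralBox ↥(maximalRealSubfield L) (Fin 3) v)).toReal⁻¹ •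
          ∫ p : Fin 3 → v.adicCompletion ↥(maximalRealSubfield L),
            ((((∏ w' : PlacesOver L v, max 1 (max ((normAbs (w'.1.adicCompletion L) (quadraticLocalEquiv L v (IsCMField.complexConj L) hcδ hδ (p 0, p 1) w') : ℝ≥0) : ℝ)
          ((normAbs (w'.1.adicCompletion L) ((toLocalRing L v (p 2) * algebraMap L (LocalRing L v) δ -
            toLocalRing L v 2⁻¹ * (quadraticLocalEquiv L v (IsCMField.complexConj L) hcδ hδ (p 0, p 1) *
              conjLocal L (IsCMField.complexConj L) v (quadraticLocalEquiv L v (IsCMField.complexConj L) hcδ hδ (p 0, p 1)))) w') : ℝ≥0) : ℝ))) : ℝ) : ℂ) ^ (-z)) *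
              (∏ w' : PlacesOver L v, (adeleAddCharAt L w'.1 ((ξ : w'.1.adicCompletion L) * quadraticLocalEquiv L v (IsCMField.complexConj L) hcδ hδ (p 0, p 1) w') : ℂ))
            ∂(Measure.pi fun _ : Fin 3 => νv v)) *
            (partialStandardL (↑S : Set (HeightOneSpectrum (𝓞 ↥(maximalRealSubfield L)))) (fun _ => {1}) z *
              partialStandardL (↑S : Set (HeightOneSpectrum (𝓞 ↥(maximalRealSubfield L)))) (fun v => {(quadraticHeckeCharCM L).valueAtUniformizer v}) z *
              partialStandardL (↑S : Set (HeightOneSpectrum (𝓞 ↥(maximalRealSubfield L)))) (fun v => {(quadraticHeckeCharCM L).valueAtUniformizer v}) (2 * z - 1))⁻¹) := by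
  haveI : IsTotallyComplex L := IsCMField.isTotallyComplex L
  haveI : SecondCountableTopology (FiniteAdeleRing (𝓞 ↥(maximalRealSubfield L)) ↥(maximalRealSubfield L)) := secondCountableTopology_finiteAdeleRing _
  haveI : LocallyCompactSpace (FiniteAdeleRing (𝓞 ↥(maximalRealSubfield L)) ↥(maximalRealSubfield L)) := locallyCompactSpace_finiteAdeleRing' _
  haveI : SecondCountableTopology (FiniteAdeleRing (𝓞 L) L) := secondCountableTopology_finiteAdeleRing L
  haveI : LocallyCompactSpace (FiniteAdeleRing (𝓞 L) L) := locallyCompactSpace_finiteAdeleRing' L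
  obtain ⟨C', hC', hfinite⟩ := exists_pos_integral_prod_heightFactor_cpow_mul_addChar_eq L hcδ hδ μFf μEf hd νv
  refine ⟨C', hC', fun S₀ hgood ξ hξ S z hz hfin hW => ?_⟩
  -- §3: the symbol is a pure tensor; ★ W3-ENGINE splits `𝓕_E`
  rw [centreAverage_eq_tensor L hc hcδ hδ hk μFf hσF _ φ₀ z,
    adeleFourierCoeff_map_split_eq_mul L (volume : Measure (mixedSpace L)) μEf hσE
      (fun s : mixedSpace L => (∏ w : InfinitePlace L, ∫ x : ℝ, ((((1 + ‖s.2 ⟨w, IsTotallyComplex.isComplex w⟩‖ ^ 2 / 2) ^ 2 + (w δ) ^ 2 * x ^ 2 : ℝ)) : ℂ) ^ (-z)))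
      (fun Xf : FiniteAdeleRing (𝓞 L) L => ((((((volume : Measure (mixedSpace ↥(maximalRealSubfield L))).prod μFf).map σF) (adeleFundamentalDomain ↥(maximalRealSubfield L))).toReal⁻¹ : ℝ) : ℂ) * φ₀ * ∫ b : FiniteAdeleRing (𝓞 ↥(maximalRealSubfield L)) ↥(maximalRealSubfield L), ((((∏ᶠ w : HeightOneSpectrum (𝓞 L), max 1 (max ‖((((0 : InfiniteAdeleRing L)), Xf) : AdeleRing (𝓞 L) L).2 w‖₊ ‖(heisZ (c := IsCMField.complexConj L) ((((0 : InfiniteAdeleRing L)), Xf) : AdeleRing (𝓞 L) L) ((traceZeroLine ↥(maximalRealSubfield L) L (IsCMField.complexConj L) hcδ hδ ((0, b) : AdeleRing (𝓞 ↥(maximalRealSubfield L)) ↥(maximalRealSubfield L)) : traceZeroAdele ↥(maximalRealSubfield L) L (IsCMField.complexConj L)) : AdeleRing (𝓞 L) L)).2 w‖₊) : ℝ≥0) : ℝ) : ℂ) ^ (-z)) ∂μFf) ξ]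
  -- the archimedean factor (★ W3-ENGINE-ℂ §3, `1 < Re z`)
  rw [integral_prod_archCentre_mul_fourierChar_eq_prod L (fun w : InfinitePlace L => (w δ : ℝ)) (fun w => InfinitePlace.pos_iff.2 hδ) ξ hz]
  -- the finite factor: Fubini (the letter `hfin`) and ★ (U3C-a)
  have hψm : AEStronglyMeasurable (fun q : FiniteAdeleRing (𝓞 L) L × FiniteAdeleRing (𝓞 ↥(maximalRealSubfield L)) ↥(maximalRealSubfield L) => (finiteAdeleAddChar L (algebraMap L (FiniteAdeleRing (𝓞 L) L) ξ * (q.1)) : ℂ)) (μEf.prod μFf) :=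
    (continuous_subtype_val.comp ((continuous_finiteAdeleAddChar L).comp (continuous_const.mul continuous_fst))).aestronglyMeasurable
  have hFψ : Integrable (fun q : FiniteAdeleRing (𝓞 L) L × FiniteAdeleRing (𝓞 ↥(maximalRealSubfield L)) ↥(maximalRealSubfield L) =>
      ((((∏ᶠ w : HeightOneSpectrum (𝓞 L), max 1 (max ‖((((0 : InfiniteAdeleRing L)), q.1) : AdeleRing (𝓞 L) L).2 w‖₊ ‖(heisZ (c := IsCMField.complexConj L) ((((0 : InfiniteAdeleRing L)), q.1) : AdeleRing (𝓞 L) L) ((traceZeroLine ↥(maximalRealSubfield L) L (IsCMField.complexConj L) hcδ hδ ((0, q.2) : AdeleRing (𝓞 ↥(maximalRealSubfield L)) ↥(maximalRealSubfield L)) : traceZeroAdele ↥(maximalRealSubfield L) L (IsCMField.complexConj L)) : AdeleRing (𝓞 L) L)).2 w‖₊) : ℝ≥0) : ℝ) : ℂ) ^ (-z)) * (finiteAdeleAddChar L (algebraMap L (FiniteAdeleRing (𝓞 L) L) ξ * (q.1)) : ℂ)) (μEf.prod μFf) :=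
    hfin.mul_bdd (c := 1) hψm (Eventually.of_forall fun q => by rw [Circle.norm_coe])
  have hfub : ∫ Xf : FiniteAdeleRing (𝓞 L) L, ∫ b : FiniteAdeleRing (𝓞 ↥(maximalRealSubfield L)) ↥(maximalRealSubfield L),
      ((((∏ᶠ w : HeightOneSpectrum (𝓞 L), max 1 (max ‖((((0 : InfiniteAdeleRing L)), Xf) : AdeleRing (𝓞 L) L).2 w‖₊ ‖(heisZ (c := IsCMField.complexConj L) ((((0 : InfiniteAdeleRing L)), Xf) : AdeleRing (𝓞 L) L) ((traceZeroLine ↥(maximalRealSubfield L) L (IsCMField.complexConj L) hcδ hδ ((0, b) : AdeleRing (𝓞 ↥(maximalRealSubfield L)) ↥(maximalRealSubfield L)) : traceZeroAdele ↥(maximalRealSubfield L) L (IsCMField.complexConj L)) : AdeleRing (𝓞 L) L)).2 w‖₊) : ℝ≥0) : ℝ) : ℂ) ^ (-z)) * (finiteAdeleAddChar L (algebraMap L (FiniteAdeleRing (𝓞 L) L) ξ * (Xf)) : ℂ) ∂μFf ∂μEf =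
      ∫ q : FiniteAdeleRing (𝓞 L) L × FiniteAdeleRing (𝓞 ↥(maximalRealSubfield L)) ↥(maximalRealSubfield L),
        ((((∏ᶠ w : HeightOneSpectrum (𝓞 L), max 1 (max ‖((((0 : InfiniteAdeleRing L)), q.1) : AdeleRing (𝓞 L) L).2 w‖₊ ‖(heisZ (c := IsCMField.complexConj L) ((((0 : InfiniteAdeleRing L)), q.1) : AdeleRing (𝓞 L) L) ((traceZeroLine ↥(maximalRealSubfield L) L (IsCMField.complexConj L) hcδ hδ ((0, q.2) : AdeleRing (𝓞 ↥(maximalRealSubfield L)) ↥(maximalRealSubfield L)) : traceZeroAdele ↥(maximalRealSubfield L) L (IsCMField.complexConj L)) : AdeleRing (𝓞 L) L)).2 w‖₊) : ℝ≥0) : ℝ) : ℂ) ^ (-z)) * (finiteAdeleAddChar L (algebraMap L (FiniteAdeleRing (𝓞 L) L) ξ * (q.1)) : ℂ) ∂(μEf.prod μFf) :=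
    (integral_prod _ hFψ).symm
  have hinner : ∀ Xf : FiniteAdeleRing (𝓞 L) L,
      (((((((volume : Measure (mixedSpace ↥(maximalRealSubfield L))).prod μFf).map σF) (adeleFundamentalDomain ↥(maximalRealSubfield L))).toReal⁻¹ : ℝ) : ℂ) * φ₀ * ∫ b : FiniteAdeleRing (𝓞 ↥(maximalRealSubfield L)) ↥(maximalRealSubfield L), ((((∏ᶠ w : HeightOneSpectrum (𝓞 L), max 1 (max ‖((((0 : InfiniteAdeleRing L)), Xf) : AdeleRing (𝓞 L) L).2 w‖₊ ‖(heisZ (c := IsCMField.complexConj L) ((((0 : InfiniteAdeleRing L)), Xf) : AdeleRing (𝓞 L) L) ((traceZeroLine ↥(maximalRealSubfield L) L (IsCMField.complexConj L) hcδ hδ ((0, b) : AdeleRing (𝓞 ↥(maximalRealSubfield L)) ↥(maximalRealSubfield L)) : traceZeroAdele ↥(maximalRealSubfield L) L (IsCMField.complexConj L)) : AdeleRing (𝓞 L) L)).2 w‖₊) : ℝ≥0) : ℝ) : ℂ) ^ (-z)) ∂μFf) * (finiteAdeleAddChar L (algebraMap L (FiniteAdeleRing (𝓞 L) L) ξ *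 (Xf)) : ℂ) =
        ((((((volume : Measure (mixedSpace ↥(maximalRealSubfield L))).prod μFf).map σF) (adeleFundamentalDomain ↥(maximalRealSubfield L))).toReal⁻¹ : ℝ) : ℂ) * φ₀ * ∫ b : FiniteAdeleRing (𝓞 ↥(maximalRealSubfield L)) ↥(maximalRealSubfield L), ((((∏ᶠ w : HeightOneSpectrum (𝓞 L), max 1 (max ‖((((0 : InfiniteAdeleRing L)), Xf) : AdeleRing (𝓞 L) L).2 w‖₊ ‖(heisZ (c := IsCMField.complexConj L) ((((0 : InfiniteAdeleRing L)), Xf) : AdeleRing (𝓞 L) L) ((traceZeroLine ↥(maximalRealSubfield L) L (IsCMField.complexConj L) hcδ hδ ((0, b) : AdeleRing (𝓞 ↥(maximalRealSubfield L)) ↥(maximalRealSubfield L)) : traceZeroAdele ↥(maximalRealSubfield L) L (IsCMField.complexConj L)) : AdeleRing (𝓞 L) L)).2 w‖₊) : ℝ≥0) : ℝ) : ℂ) ^ (-z)) * (finiteAdeleAddChar L (algebraMap L (FiniteAdeleRing (𝓞 L) L) ξ * (Xf)) : ℂ) ∂μFf := fun Xf => by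
    rw [mul_assoc, ← integral_mul_const]
  simp_rw [hinner]
  rw [integral_const_mul, hfub, hfinite 0 S₀ hgood ξ hξ S hz hfin hW]
  simp only [Complex.real_smul]
  ring

end Summit.HodgeConjecture.HodgeConjecture.Cruxes.H413.K2E1WhittakerCoefficientEulerProductU3C

end
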